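import Mathlib
import Summits.NavierStokesRegularity.NavierStokesRegularity.Theorems.DssFarFieldSlavingBlowupTypeIDssProfileSimilarityEnstrophyTimeThreshold
import Summits.NavierStokesRegularity.NavierStokesRegularity.Theorems.DssFarFieldSlavingBlowupTypeIDssProfileSimilarityEnstrophyHardyCore
import Summits.NavierStokesRegularity.NavierStokesRegularity.Theorems.DssFarFieldSlavingBlowupTypeIDssProfileGaussianTypeIPackage
import Summits.NavierStokesRegularity.NavierStokesRegularity.Theorems.DssFarFieldSlavingBlowupTypeIDssProfileGaussianSmallTypeIIdentities
import Summits.NavierStokesRegularity.NavierStokesRegularity.Theorems.DssFarFieldSlavingBlowupTypeIDssProfileSmoothRepresentativeAe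
import Literature.Analysis.FluidPDE.TypeIAncientMildDecay
import HarnessLib

/-!
# E3′ / T31‴: the space-only Type-I threshold `A ≤ ½` — classical (unconditional) and the
  space-constant PORTRAIT FLOOR at CLASS level (pub-ns-dss T38/T31 scope «Row 5», theory
  EXPLICIT-THRESHOLDS row T31‴ [theory g10 2026-08-23T12:32:25Z: «ROW-5 CANDIDATE»]; route
  `DssFarFieldSlaving`, crux `BlowupTypeIDssProfile`, stmt-NavierStokesRegularity-0155 — SUPPORT;
  typer seat g8, 2026-08-23)

HONEST FRAMING. Exclusion statements about a HYPOTHETICAL object (a Type-I ancient mild solution in the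
KNSS gauge / a member of the rotated-DSS Type-I class). CLASSICAL (theory T31‴, «A_sp ≤ ½ ⇒ u ≡ 0»): a
KNSS-gauge Type-I field `V` (ANY time-only constant `M`, `‖V(t,x)‖ ≤ M/√(−t)`) whose SPACE-ONLY constant
`A` (`‖x‖ ‖V(t,x)‖ ≤ A` for all `t < 0`, `x`) satisfies `A ≤ ½` vanishes — UNCONDITIONALLY: the decay
input (D) of the similarity-enstrophy identity is supplied by the tree's Literature theorem
`IsTypeIAncientMild.gaugeBounds_of_hasTypeIDecay` through the envelope `HasTypeIDecay (M + A) V`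
(`hasTypeIDecay_of_typeI_of_spaceConstant`). CLASS: (i) the tree's CONDITIONAL wrapper
`ExplicitThreshold.rdssClass_empty_of_explicitSpaceThreshold` (hypothesis `h` = T31‴) has `h` DISCHARGED
(`spaceThreshold_hypothesis_holds`) — its `M ≤ ½` conclusion is census-REDUNDANT (it is contained in the
tree's `SimilarityEnstrophy.rdssClass_empty_of_typeI_lt_one`, every `M < 1`) and is recorded only because
it turns a conditional tree statement into a theorem; (ii) the non-redundant content is the ∀-representative
PORTRAIT FLOOR `rdssClass_empty_of_spaceConstant`: at EVERY space–time Type-I level `M`, no non-trivial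
member has all its smooth KNSS representatives obeying `‖x‖‖V(t,x)‖ ≤ A` with `A ≤ ½` — i.e. every survivor
has space-only constant `A_sp > ½` whatever its time-only constant (the two-constant floor
`GaussianGap.rdssClass_empty_of_twoConstant` covers `A ≤ ½` only for `M_t² < 5/2`). MECHANISM (the monotone
quantity): the UNWEIGHTED similarity enstrophy `Z(s) = ∫‖Ω(s)‖²` with the tree identity
`½Z′ = −∫|∇Ω|²_F − ¼Z + Str` (`similarityEnstrophy_hasDerivAt`); the stretching is moved onto `U`
(`∫Ωᵀ(∇U)Ω = −∫U·((Ω·∇)Ω)`, `div Ω = 0`) and bounded with `‖U‖ ≤ A/‖y‖`, Young and the vector HARDY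
inequality `∫‖Ω‖²/‖y‖² ≤ 4∫|∇Ω|²_F`: `Str ≤ 2A ∫|∇Ω|²_F`, so for `A ≤ ½` the stretching is absorbed by
the dissipation and `Z′ ≤ −½Z` on `s ∈ ℝ` with `Z ≥ 0` bounded ⇒ `Z ≡ 0` ⇒ `V ≡ 0`. The threshold `½` is
what Hardy's constant `4` gives; no sharpness is claimed. DSS-BLIND: the class proofs discard `c`, `R`,
`IsRotatedDSS`. Derivation: theory seat (EXPLICIT-THRESHOLDS T31‴, DERIVED, red ×2 PASS 2026-08-22 on the
bundle); typed here on the S1/S4 kit (Row 2 `…TimeThreshold`, `…HardyCore`). PRINTED CONTEXT (theory's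
line, comparators only): steady relatives with the Hardy constant (Borchers–Miyakawa 1995; Galdi, Ch. X);
nothing is quoted from print. Census words on ACCEPT, if any, are the lead's. Nothing numeric about any
candidate; nothing here bears on Navier–Stokes regularity or blow-up.
-/

noncomputable section

set_option linter.dupNamespace false

namespace Summit.NavierStokesRegularity.NavierStokesRegularity.Theorems.SimilarityEnstrophy

open MeasureTheory Set Filter Topology Module Metric InnerProductSpace Function
open scoped RealInnerProductSpace Laplacian ContDiff ENNReal
open Literature.Analysis Literature.Analysis.FluidPDE Literature.Analysis.Calculus
open Summit.NavierStokesRegularity.NavierStokesRegularity.Theorems.GaussianGap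
open Summit.NavierStokesRegularity.NavierStokesRegularity.Theorems.PlanarEnergyAPriori

variable {M : ℝ} {V : ℝ → EuclideanSpace ℝ (Fin 3) → EuclideanSpace ℝ (Fin 3)}

/-- **Hardy for the similarity vorticity, real-integral form.** Under (D) at orders `1, 2` the function
`‖Ω(s,y)‖²/‖y‖²` is integrable and `∫ ‖Ω‖²/‖y‖² ≤ 4 ∫ |∇Ω|²_F` (the vector Hardy inequality
`hardy_sq_lintegral_le_of_decay_vec` about the origin, transported from `ℝ≥0∞` as in
`integral_stretching_le_integral_frobeniusNormSq`). [folklore] -/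
theorem integral_norm_sq_div_norm_sq_le (hV : IsTypeIAncientMild M V) {C₁ C₂ : ℝ}
    (hD1 : ∀ t < 0, ∀ x, (‖x‖ + Real.sqrt (-t)) ^ (1 + 1) * ‖iteratedFDeriv ℝ 1 (V t) x‖ ≤ C₁)
    (hD2 : ∀ t < 0, ∀ x, (‖x‖ + Real.sqrt (-t)) ^ (2 + 1) * ‖iteratedFDeriv ℝ 2 (V t) x‖ ≤ C₂)
    (s : ℝ) :
    Integrable (fun y => ‖lerayVorticity V s y‖ ^ 2 / ‖y‖ ^ 2) ∧
      ∫ y, ‖lerayVorticity V s y‖ ^ 2 / ‖y‖ ^ 2 ≤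
        4 * ∫ y, frobeniusNormSq (fderiv ℝ (lerayVorticity V s) y) := by
  have hΩ := contDiff_lerayVorticity_slice hV s
  have hΩ1 : ContDiff ℝ 1 (lerayVorticity V s) := hΩ.of_le (by norm_cast)
  have iF := integrable_frobeniusNormSq_fderiv_lerayVorticity hV hD2 s
  -- decay of `Ω(s)`: `‖y‖ ‖Ω(s,y)‖ ≤ ‖curl‖ C₁`
  have hc₀ := decayConst_nonneg hD1
  have hdec : ∀ y : EuclideanSpace ℝ (Fin 3), 1 < ‖y‖ →
      ‖y‖ * ‖lerayVorticity V s y‖ ≤ ‖curlCLM‖ * C₁ := by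
    intro y _
    have h := norm_lerayVorticity_le_decay hV hD1 s y
    have hy : ‖y‖ ≤ 1 + ‖y‖ := by linarith [norm_nonneg y]
    have hpow : (1 + ‖y‖) ^ (-(2 : ℝ)) ≤ (1 + ‖y‖)⁻¹ := by
      have := SlabLaw.rpow_neg_le_rpow_neg_of_le y (show (1 : ℝ) ≤ 2 by norm_num)
      rwa [Real.rpow_neg_one] at this
    have h1 : 0 < 1 + ‖y‖ := by positivity
    calc ‖y‖ * ‖lerayVorticity V s y‖
        ≤ (1 + ‖y‖) * (‖curlCLM‖ * C₁ * (1 + ‖y‖) ^ (-(2 : ℝ))) :=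
          mul_le_mul hy h (norm_nonneg _) (by positivity)
      _ ≤ (1 + ‖y‖) * (‖curlCLM‖ * C₁ * (1 + ‖y‖)⁻¹) := by gcongr
      _ = ‖curlCLM‖ * C₁ := by field_simp
  -- Hardy in `ℝ≥0∞`
  have hH := hardy_sq_lintegral_le_of_decay_vec hΩ1 one_pos hdec
  have hsum : ∑ i, ∫⁻ y, ENNReal.ofReal (‖fderiv ℝ (fun z => lerayVorticity V s z i) y‖ ^ 2) =
      ∫⁻ y, ENNReal.ofReal (frobeniusNormSq (fderiv ℝ (lerayVorticity V s) y)) := by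
    rw [← lintegral_finsetSum _ fun i _ => ?_]
    · refine lintegral_congr fun y => ?_
      rw [frobeniusNormSq_fderiv_eq_sum_norm_fderiv_coord_sq ((hΩ1.differentiable one_ne_zero) y),
        ENNReal.ofReal_sum_of_nonneg fun i _ => sq_nonneg _]
    · exact ((((contDiff_euclidean.1 hΩ1 i).continuous_fderiv one_ne_zero).norm).pow
        2).measurable.ennreal_ofReal
  have hFlin : ∫⁻ y, ENNReal.ofReal (frobeniusNormSq (fderiv ℝ (lerayVorticity V s) y)) =
      ENNReal.ofReal (∫ y, frobeniusNormSq (fderiv ℝ (lerayVorticity V s) y)) :=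
    (ofReal_integral_eq_lintegral_ofReal iF
      (Eventually.of_forall fun y => frobeniusNormSq_nonneg _)).symm
  rw [hsum, hFlin] at hH
  -- the Hardy majorant is integrable
  set h : EuclideanSpace ℝ (Fin 3) → ℝ := fun y => ‖lerayVorticity V s y‖ ^ 2 / ‖y‖ ^ 2 with hh
  have hmeas : AEStronglyMeasurable h volume :=
    ((hΩ.continuous.norm.pow 2).measurable.div
      (continuous_norm.pow 2).measurable).aestronglyMeasurable
  have hnn : 0 ≤ᵐ[volume] h := Eventually.of_forall fun y => by positivity
  have hfin : ∫⁻ y, ENNReal.ofReal (h y) < (⊤ : ℝ≥0∞) :=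
    lt_of_le_of_lt hH (ENNReal.mul_lt_top (by norm_num) ENNReal.ofReal_lt_top)
  have hint : Integrable h := by
    refine ⟨hmeas, ?_⟩
    rw [hasFiniteIntegral_iff_norm]
    refine lt_of_le_of_lt (le_of_eq ?_) hfin
    refine lintegral_congr fun y => ?_
    rw [Real.norm_of_nonneg (by positivity)]
  refine ⟨hint, ?_⟩
  have e1 : ENNReal.ofReal (∫ y, h y) ≤
      4 * ENNReal.ofReal (∫ y, frobeniusNormSq (fderiv ℝ (lerayVorticity V s) y)) := by
    rw [ofReal_integral_eq_lintegral_ofReal hint hnn]; exact hH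
  have hFnn : 0 ≤ ∫ y, frobeniusNormSq (fderiv ℝ (lerayVorticity V s) y) :=
    integral_nonneg fun y => frobeniusNormSq_nonneg _
  rw [show (4 : ℝ≥0∞) = ENNReal.ofReal 4 by norm_num, ← ENNReal.ofReal_mul (by norm_num)] at e1
  exact (ENNReal.ofReal_le_ofReal_iff (by positivity)).1 e1

/-- **The stretching bound from the SPACE-only constant** (theory EXPLICIT-THRESHOLDS row T31‴):
`Str(s) = ∫⟪Ω, DU Ω⟫ ≤ 2A ∫|∇Ω(s)|²_F` for a KNSS-gauge Type-I field with `‖x‖‖V(t,x)‖ ≤ A`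
(`‖y‖‖U(s,y)‖ ≤ A` in similarity variables) under (D) at `k = 1, 2`: move the derivative onto `Ω`
(`∫ Ωᵀ(∇U)Ω = −∫ U·((Ω·∇)Ω)`, `div Ω = 0`), bound `|U·((Ω·∇)Ω)| ≤ (A/‖y‖) ‖Ω‖ ‖DΩ‖_op ≤
ε|DΩ|²_F + (A²/4ε) ‖Ω‖²/‖y‖²` for every `ε > 0`, integrate with Hardy `∫‖Ω‖²/‖y‖² ≤ 4∫|∇Ω|²_F`,
and optimise in `ε`. [this file; theory T31‴] -/
theorem integral_stretching_le_of_spaceConstant (hV : IsTypeIAncientMild M V) {C₁ C₂ : ℝ}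
    (hD1 : ∀ t < 0, ∀ x, (‖x‖ + Real.sqrt (-t)) ^ (1 + 1) * ‖iteratedFDeriv ℝ 1 (V t) x‖ ≤ C₁)
    (hD2 : ∀ t < 0, ∀ x, (‖x‖ + Real.sqrt (-t)) ^ (2 + 1) * ‖iteratedFDeriv ℝ 2 (V t) x‖ ≤ C₂)
    {A : ℝ} (hA : ∀ t < 0, ∀ x, ‖x‖ * ‖V t x‖ ≤ A) (s : ℝ) :
    ∫ y, ⟪lerayVorticity V s y, fderiv ℝ (lerayOrbit V s) y (lerayVorticity V s y)⟫ ≤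
      2 * A * ∫ y, frobeniusNormSq (fderiv ℝ (lerayVorticity V s) y) := by
  have hΩ := contDiff_lerayVorticity_slice hV s
  have hU : ContDiff ℝ ∞ (lerayOrbit V s) := contDiff_lerayOrbit_slice_of_typeI hV s le_rfl
  have hdiv : VectorCalculus.IsDivFree (lerayVorticity V s) := fun y =>
    divergence_curl_eq_zero_holds _ (hU.of_le (by norm_cast)) y
  have iZ := integrable_norm_lerayVorticity_sq hV hD1 s
  have iF := integrable_frobeniusNormSq_fderiv_lerayVorticity hV hD2 s
  have iS := integrable_inner_stretching_lerayVorticity hV hD1 s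
  have iT := integrable_inner_lerayOrbit_convect_lerayVorticity hV hD1 hD2 s
  obtain ⟨hint, hHardy⟩ := integral_norm_sq_div_norm_sq_le hV hD1 hD2 s
  have hA0 : 0 ≤ A := by simpa using hA (-1) (by norm_num) 0
  have hUA : ∀ y, ‖y‖ * ‖lerayOrbit V s y‖ ≤ A := norm_mul_norm_lerayOrbit_le hA s
  -- integration by parts: `Str = −∫⟪U, (Ω·∇)Ω⟫`
  have iS' : Integrable fun y =>
      ⟪convect (lerayVorticity V s) (lerayOrbit V s) y, lerayVorticity V s y⟫ := by
    refine iS.congr (Eventually.of_forall fun y => ?_)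
    simp only [convect_apply]
    exact real_inner_comm _ _
  have hIBP := integral_inner_convect_eq_neg_integral_inner_convect_self hΩ hU hdiv
    (fun y => norm_lerayOrbit_le_of_typeI hV s y) iZ iS' iT
  have hStr : ∫ y, ⟪lerayVorticity V s y, fderiv ℝ (lerayOrbit V s) y (lerayVorticity V s y)⟫ =
      -∫ y, ⟪lerayOrbit V s y, convect (lerayVorticity V s) (lerayVorticity V s) y⟫ := by
    rw [← hIBP]
    refine integral_congr_ae (Eventually.of_forall fun y => ?_)
    simp only [convect_apply]
    exact real_inner_comm _ _
  rw [hStr, ← integral_neg]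
  -- notation for the three integrals
  set D : ℝ := ∫ y, frobeniusNormSq (fderiv ℝ (lerayVorticity V s) y) with hD
  set H : ℝ := ∫ y, ‖lerayVorticity V s y‖ ^ 2 / ‖y‖ ^ 2 with hH
  have hD0 : 0 ≤ D := integral_nonneg fun y => frobeniusNormSq_nonneg _
  have hH0 : 0 ≤ H := integral_nonneg fun y => by positivity
  -- Young for every `ε > 0`, then Hardy
  have hε : ∀ ε : ℝ, 0 < ε →
      ∫ y, -⟪lerayOrbit V s y, convect (lerayVorticity V s) (lerayVorticity V s) y⟫ ≤
        ε * D + A ^ 2 * H / (4 * ε) := by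
    intro ε hε
    have hy0 : ∀ᵐ y ∂(volume : Measure (EuclideanSpace ℝ (Fin 3))), y ≠ 0 := by
      have : (volume : Measure (EuclideanSpace ℝ (Fin 3))) {0} = 0 := measure_singleton 0
      refine ae_iff.2 ?_
      simp only [ne_eq, not_not, setOf_eq_eq_singleton]
      exact this
    have hae : ∀ᵐ y ∂volume,
        -⟪lerayOrbit V s y, convect (lerayVorticity V s) (lerayVorticity V s) y⟫ ≤
          ε * frobeniusNormSq (fderiv ℝ (lerayVorticity V s) y) +
            A ^ 2 / (4 * ε) * (‖lerayVorticity V s y‖ ^ 2 / ‖y‖ ^ 2) := by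
      filter_upwards [hy0] with y hy
      have hypos : 0 < ‖y‖ := norm_pos_iff.2 hy
      set a := ‖fderiv ℝ (lerayVorticity V s) y‖ with ha
      set b := ‖lerayVorticity V s y‖ with hb
      set c := A / ‖y‖ * b with hc
      have ha0 : 0 ≤ a := norm_nonneg _
      have hb0 : 0 ≤ b := norm_nonneg _
      have hUy : ‖lerayOrbit V s y‖ ≤ A / ‖y‖ := by
        rw [le_div_iff₀ hypos, mul_comm]; exact hUA y
      have hop := sq_opNorm_le_frobeniusNormSq (fderiv ℝ (lerayVorticity V s) y)
      have h1 : -⟪lerayOrbit V s y, convect (lerayVorticity V s) (lerayVorticity V s) y⟫ ≤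
          a * c := by
        calc -⟪lerayOrbit V s y, convect (lerayVorticity V s) (lerayVorticity V s) y⟫
            ≤ ‖⟪lerayOrbit V s y, convect (lerayVorticity V s) (lerayVorticity V s) y⟫‖ := by
              rw [Real.norm_eq_abs]; exact neg_le_abs _
          _ ≤ ‖lerayOrbit V s y‖ * ‖convect (lerayVorticity V s) (lerayVorticity V s) y‖ :=
              norm_inner_le_norm _ _
          _ ≤ (A / ‖y‖) * (a * b) := by
              rw [convect_apply]
              exact mul_le_mul hUy (ContinuousLinearMap.le_opNorm _ _) (norm_nonneg _)
                (div_nonneg hA0 hypos.le)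
          _ = a * c := by rw [hc]; ring
      have h2 : a * c ≤ ε * a ^ 2 + c ^ 2 / (4 * ε) := by
        have h4 : 0 < 4 * ε := by positivity
        have : ε * a ^ 2 + c ^ 2 / (4 * ε) - a * c = (2 * ε * a - c) ^ 2 / (4 * ε) := by
          field_simp; ring
        have hnn : 0 ≤ (2 * ε * a - c) ^ 2 / (4 * ε) := by positivity
        linarith
      have h3 : c ^ 2 = A ^ 2 * (b ^ 2 / ‖y‖ ^ 2) := by rw [hc]; ring
      have h4 : ε * a ^ 2 ≤ ε * frobeniusNormSq (fderiv ℝ (lerayVorticity V s) y) :=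
        mul_le_mul_of_nonneg_left hop hε.le
      have h5 : c ^ 2 / (4 * ε) = A ^ 2 / (4 * ε) * (b ^ 2 / ‖y‖ ^ 2) := by rw [h3]; ring
      linarith
    calc ∫ y, -⟪lerayOrbit V s y, convect (lerayVorticity V s) (lerayVorticity V s) y⟫
        ≤ ∫ y, (ε * frobeniusNormSq (fderiv ℝ (lerayVorticity V s) y) +
            A ^ 2 / (4 * ε) * (‖lerayVorticity V s y‖ ^ 2 / ‖y‖ ^ 2)) :=
          integral_mono_ae iT.neg ((iF.const_mul _).add (hint.const_mul _)) hae
      _ = ε * D + A ^ 2 / (4 * ε) * H := by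
          rw [integral_add (iF.const_mul _) (hint.const_mul _), integral_const_mul,
            integral_const_mul]
      _ = ε * D + A ^ 2 * H / (4 * ε) := by ring
  have hX := le_sqrt_mul_sqrt_of_forall_le hD0 (by positivity : 0 ≤ A ^ 2 * H) hε
  -- `√D · √(A² H) ≤ √D · √(4 A² D) = 2 A D`
  have hAH : A ^ 2 * H ≤ (2 * A) ^ 2 * D := by nlinarith [sq_nonneg A]
  calc ∫ y, -⟪lerayOrbit V s y, convect (lerayVorticity V s) (lerayVorticity V s) y⟫
      ≤ Real.sqrt D * Real.sqrt (A ^ 2 * H) := hX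
    _ ≤ Real.sqrt D * Real.sqrt ((2 * A) ^ 2 * D) :=
        mul_le_mul_of_nonneg_left (Real.sqrt_le_sqrt hAH) (Real.sqrt_nonneg _)
    _ = Real.sqrt D * (2 * A * Real.sqrt D) := by
        rw [Real.sqrt_mul (sq_nonneg _), Real.sqrt_sq (by positivity)]
    _ = 2 * A * (Real.sqrt D * Real.sqrt D) := by ring
    _ = 2 * A * D := by rw [Real.mul_self_sqrt hD0]

/-- **T31‴ under (D), CLASSICAL level** (theory EXPLICIT-THRESHOLDS row T31‴). Let `V` be a KNSS-gauge
Type-I field (`IsTypeIAncientMild M V`, ANY `M`) with space-only constant `A ≤ ½`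
(`‖x‖ ‖V(t,x)‖ ≤ A`) and the scale-invariant gauge bounds (D) of orders `1, 2, 3`. Then `V ≡ 0` on
`t < 0`: `½Z' = −∫|∇Ω|²_F − ¼Z + Str` with `Str ≤ 2A∫|∇Ω|²_F ≤ ∫|∇Ω|²_F` gives `Z' ≤ −½Z`; `Z ≥ 0` is
bounded on `ℝ` by (D₁), so `Z ≡ 0` (`eq_zero_of_deriv_le_neg_half_mul`), and `Z ≡ 0 ⇒ V ≡ 0`.
[this file; theory T31‴ («A_sp ≤ ½ ⇒ u ≡ 0», DERIVED); here a tree theorem GIVEN (D); see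
`typeI_ancient_eq_zero_of_spaceConstant_le_half` for the unconditional form] -/
theorem typeI_ancient_eq_zero_of_spaceConstant_le_half_of_decay (hV : IsTypeIAncientMild M V)
    {A : ℝ} (hA : ∀ t < 0, ∀ x, ‖x‖ * ‖V t x‖ ≤ A) (hAh : A ≤ 1 / 2) {C₁ C₂ C₃ : ℝ}
    (hD1 : ∀ t < 0, ∀ x, (‖x‖ + Real.sqrt (-t)) ^ (1 + 1) * ‖iteratedFDeriv ℝ 1 (V t) x‖ ≤ C₁)
    (hD2 : ∀ t < 0, ∀ x, (‖x‖ + Real.sqrt (-t)) ^ (2 + 1) * ‖iteratedFDeriv ℝ 2 (V t) x‖ ≤ C₂)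
    (hD3 : ∀ t < 0, ∀ x, (‖x‖ + Real.sqrt (-t)) ^ (3 + 1) * ‖iteratedFDeriv ℝ 3 (V t) x‖ ≤ C₃) :
    ∀ t < 0, ∀ x, V t x = 0 := by
  set Z : ℝ → ℝ := fun σ => ∫ y, ‖lerayVorticity V σ y‖ ^ 2 with hZ
  have hZd := fun σ => similarityEnstrophy_hasDerivAt hV hD1 hD2 hD3 σ
  have hdiff : Differentiable ℝ Z := fun σ => (hZd σ).differentiableAt
  have hZ0 : ∀ σ, 0 ≤ Z σ := fun σ => integral_nonneg fun y => by positivity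
  -- `Z` bounded, from (D₁)
  have hc₀ := decayConst_nonneg hD1
  have hcont : Continuous fun y : EuclideanSpace ℝ (Fin 3) =>
      (‖curlCLM‖ * C₁) ^ 2 * (1 + ‖y‖) ^ (-(4 : ℝ)) :=
    continuous_const.mul ((continuous_const.add continuous_norm).rpow_const
      fun y => Or.inl (add_pos_of_pos_of_nonneg one_pos (norm_nonneg y)).ne')
  have imaj : Integrable fun y : EuclideanSpace ℝ (Fin 3) =>
      (‖curlCLM‖ * C₁) ^ 2 * (1 + ‖y‖) ^ (-(4 : ℝ)) :=
    integrable_of_le_decay_four hcont (K := (‖curlCLM‖ * C₁) ^ 2) fun y => by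
      rw [Real.norm_of_nonneg (by positivity)]
  have hbdd : ∃ B, ∀ σ, Z σ ≤ B := by
    refine ⟨∫ y : EuclideanSpace ℝ (Fin 3), (‖curlCLM‖ * C₁) ^ 2 * (1 + ‖y‖) ^ (-(4 : ℝ)),
      fun σ => ?_⟩
    refine integral_mono (integrable_norm_lerayVorticity_sq hV hD1 σ) imaj fun y => ?_
    have h := norm_lerayVorticity_le_decay hV hD1 σ y
    calc ‖lerayVorticity V σ y‖ ^ 2 ≤ (‖curlCLM‖ * C₁ * (1 + ‖y‖) ^ (-(2 : ℝ))) ^ 2 :=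
          pow_le_pow_left₀ (norm_nonneg _) h 2
      _ = (‖curlCLM‖ * C₁) ^ 2 * ((1 + ‖y‖) ^ (-(2 : ℝ)) * (1 + ‖y‖) ^ (-(2 : ℝ))) := by ring
      _ = (‖curlCLM‖ * C₁) ^ 2 * (1 + ‖y‖) ^ (-(4 : ℝ)) := by
          rw [SlabLaw.rpow_neg_mul_rpow_neg]; norm_num
  -- `Z' ≤ −½ Z`
  have hZ' : ∀ σ, deriv Z σ ≤ -(1 / 2) * Z σ := by
    intro σ
    rw [(hZd σ).deriv]
    have hS := integral_stretching_le_of_spaceConstant hV hD1 hD2 hA σ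
    have hF0 : 0 ≤ ∫ y, frobeniusNormSq (fderiv ℝ (lerayVorticity V σ) y) :=
      integral_nonneg fun y => frobeniusNormSq_nonneg _
    have hZσ : Z σ = ∫ y, ‖lerayVorticity V σ y‖ ^ 2 := rfl
    rw [hZσ]
    nlinarith
  have hZzero := eq_zero_of_deriv_le_neg_half_mul hdiff hZ0 hbdd hZ'
  exact eq_zero_of_integral_norm_lerayVorticity_sq_eq_zero hV hD1 hZzero

/-- **Two constants give the space–time envelope**: `‖V(t,x)‖ ≤ M/√(−t)` and `‖x‖‖V(t,x)‖ ≤ A` imply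
`‖V(t,x)‖ ≤ (M + A)/(‖x‖ + √(−t))`, i.e. `HasTypeIDecay (M + A) V` (multiply out). [folklore] -/
theorem hasTypeIDecay_of_typeI_of_spaceConstant (hV : IsTypeIAncientMild M V) {A : ℝ}
    (hA : ∀ t < 0, ∀ x, ‖x‖ * ‖V t x‖ ≤ A) : HasTypeIDecay (M + A) V := by
  intro t ht x
  have hst : 0 < Real.sqrt (-t) := Real.sqrt_pos.2 (neg_pos.2 ht)
  have hden : 0 < ‖x‖ + Real.sqrt (-t) := add_pos_of_nonneg_of_pos (norm_nonneg _) hst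
  have h1 : Real.sqrt (-t) * ‖V t x‖ ≤ M := by
    have := hV.2.2.2 t ht x
    rwa [le_div_iff₀ hst, mul_comm] at this
  have h2 := hA t ht x
  rw [le_div_iff₀ hden]
  nlinarith

/-- Monotonicity of the KNSS-gauge Type-I class in its constant. [folklore] -/
theorem isTypeIAncientMild_mono (hV : IsTypeIAncientMild M V) {M' : ℝ} (hMM' : M ≤ M') :
    IsTypeIAncientMild M' V := by
  refine ⟨hV.1, hV.2.1, hV.2.2.1, fun t ht x => (hV.2.2.2 t ht x).trans ?_⟩
  exact div_le_div_of_nonneg_right hMM' (Real.sqrt_nonneg _)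

/-- **T31‴, CLASSICAL level, UNCONDITIONAL** (theory EXPLICIT-THRESHOLDS row T31‴: «A_sp ≤ ½ ⇒ u ≡ 0»):
a KNSS-gauge Type-I field `V` with ANY time-only constant `M` (`IsTypeIAncientMild M V`) and space-only
constant `A ≤ ½` (`‖x‖ ‖V(t,x)‖ ≤ A` for all `t < 0`, `x`) vanishes on `t < 0`. The decay (D) of
`typeI_ancient_eq_zero_of_spaceConstant_le_half_of_decay` is supplied by the tree's Literature theorem
`IsTypeIAncientMild.gaugeBounds_of_hasTypeIDecay` applied at the envelope constant `M + A`
(`hasTypeIDecay_of_typeI_of_spaceConstant`, `isTypeIAncientMild_mono`). NO named input.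
[this file; theory T31‴; nothing here bears on NS regularity] -/
theorem typeI_ancient_eq_zero_of_spaceConstant_le_half (hV : IsTypeIAncientMild M V) {A : ℝ}
    (hA : ∀ t < 0, ∀ x, ‖x‖ * ‖V t x‖ ≤ A) (hAh : A ≤ 1 / 2) :
    ∀ t < 0, ∀ x, V t x = 0 := by
  have hA0 : 0 ≤ A := by simpa using hA (-1) (by norm_num) 0
  have hV' : IsTypeIAncientMild (M + A) V := isTypeIAncientMild_mono hV (le_add_of_nonneg_right hA0)
  obtain ⟨C₁, C₂, C₃, hD1, hD2, hD3⟩ :=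
    IsTypeIAncientMild.gaugeBounds_of_hasTypeIDecay hV' (hasTypeIDecay_of_typeI_of_spaceConstant hV hA)
  exact typeI_ancient_eq_zero_of_spaceConstant_le_half_of_decay hV' hA hAh hD1 hD2 hD3

/-- **The hypothesis of the E3′ space wrapper HOLDS.** The hypothesis `h` of the tree's conditional
wrapper `ExplicitThreshold.rdssClass_empty_of_explicitSpaceThreshold` (theory T31‴ VERBATIM:
`IsTypeIAncientMild C₀ V`, `HasTypeIDecay C₀ V`, `‖x‖‖V(t,x)‖ ≤ ½` ⇒ `V ≡ 0`) is a THEOREM: (D) from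
`IsTypeIAncientMild.gaugeBounds_of_hasTypeIDecay`, then
`typeI_ancient_eq_zero_of_spaceConstant_le_half_of_decay` with `A = ½`. [this file] -/
theorem spaceThreshold_hypothesis_holds :
    ∀ ⦃C₀ : ℝ⦄ ⦃V : ℝ → EuclideanSpace ℝ (Fin 3) → EuclideanSpace ℝ (Fin 3)⦄,
      IsTypeIAncientMild C₀ V → HasTypeIDecay C₀ V →
      (∀ t < 0, ∀ x, ‖x‖ * ‖V t x‖ ≤ 1 / 2) → ∀ t < 0, ∀ x, V t x = 0 := by
  intro C₀ V hV hdec hhalf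
  obtain ⟨C₁, C₂, C₃, hD1, hD2, hD3⟩ := IsTypeIAncientMild.gaugeBounds_of_hasTypeIDecay hV hdec
  exact typeI_ancient_eq_zero_of_spaceConstant_le_half_of_decay hV hhalf le_rfl hD1 hD2 hD3

/-- **E3′ (space form) at CLASS level for `M ≤ ½`, UNCONDITIONAL** — the tree's conditional wrapper
`ExplicitThreshold.rdssClass_empty_of_explicitSpaceThreshold` with its T31‴ hypothesis DISCHARGED by
`spaceThreshold_hypothesis_holds`. CENSUS-REDUNDANT: contained in the tree's
`SimilarityEnstrophy.rdssClass_empty_of_typeI_lt_one` (every `M < 1`); recorded only because it turns a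
conditional tree statement into a theorem. DSS-blind. [this file; no census word attaches;
nothing here bears on NS regularity] -/
theorem rdssClass_empty_of_explicitSpaceThreshold_unconditional {M : ℝ} (hM : M ≤ 1 / 2) :
    ¬ ∃ (c : ℝ) (R : (EuclideanSpace ℝ (Fin 3)) ≃ₗᵢ[ℝ] (EuclideanSpace ℝ (Fin 3)))
        (u : ℝ → (EuclideanSpace ℝ (Fin 3)) → (EuclideanSpace ℝ (Fin 3))),
      1 < c ∧ IsAncientMildSolution 1 u ∧ (∀ t < 0, AEStronglyMeasurable (u t) volume) ∧
      IsRotatedDSS c R u ∧ HasTypeIDecay M u ∧ ¬ (∀ t < 0, u t =ᵐ[volume] 0) :=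
  ExplicitThreshold.rdssClass_empty_of_explicitSpaceThreshold spaceThreshold_hypothesis_holds hM

/-- **The space-constant PORTRAIT FLOOR at CLASS level, UNCONDITIONAL** (theory T31‴'s non-redundant
content, in the ∀-representative shape of `GaussianGap.rdssClass_empty_of_twoConstant`): at EVERY
space–time Type-I level `M`, no non-trivial member of the hypothesis class of `RdssProfileTruncation`
(any `c > 1`, ANY twist `R ∈ O(3)`) has all its smooth KNSS representatives (`IsTypeIAncientMild M V`,
`V(t) = u(t)` a.e.) obeying `‖x‖ ‖V(t,x)‖ ≤ A` with `A ≤ ½` — every survivor has space-only constant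
`A_sp > ½`, whatever its time-only constant. Proof: a smooth representative exists
(`typeI_ancient_smoothRepresentative_ae`), carries `HasTypeIDecay M V`, hence (D)
(`IsTypeIAncientMild.gaugeBounds_of_hasTypeIDecay`), and vanishes by
`typeI_ancient_eq_zero_of_spaceConstant_le_half_of_decay`. DSS-blind. [this file; theory T31‴; census
words on ACCEPT, if any, are the lead's; nothing numerical is asserted and nothing here bears on NS
regularity] -/
theorem rdssClass_empty_of_spaceConstant (M : ℝ) {A : ℝ} (hAh : A ≤ 1 / 2) :
    ¬ ∃ (c : ℝ) (R : (EuclideanSpace ℝ (Fin 3)) ≃ₗᵢ[ℝ] (EuclideanSpace ℝ (Fin 3)))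
        (u : ℝ → (EuclideanSpace ℝ (Fin 3)) → (EuclideanSpace ℝ (Fin 3))),
      1 < c ∧ IsAncientMildSolution 1 u ∧ (∀ t < 0, AEStronglyMeasurable (u t) volume) ∧
      IsRotatedDSS c R u ∧ HasTypeIDecay M u ∧
      (∀ V : ℝ → EuclideanSpace ℝ (Fin 3) → EuclideanSpace ℝ (Fin 3), IsTypeIAncientMild M V →
        (∀ t < 0, V t =ᵐ[volume] u t) → ∀ t < 0, ∀ x, ‖x‖ * ‖V t x‖ ≤ A) ∧
      ¬ (∀ t < 0, u t =ᵐ[volume] 0) := by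
  rintro ⟨c, R, u, -, hmild, hmeas, -, hdec, hrep, hne⟩
  obtain ⟨V, hT, hdecV, hVu, -⟩ := typeI_ancient_smoothRepresentative_ae hmild hmeas hdec
  have hA := hrep V hT hVu
  obtain ⟨C₁, C₂, C₃, hD1, hD2, hD3⟩ := IsTypeIAncientMild.gaugeBounds_of_hasTypeIDecay hT hdecV
  have hz : ∀ t < 0, ∀ x, V t x = 0 :=
    typeI_ancient_eq_zero_of_spaceConstant_le_half_of_decay hT hA hAh hD1 hD2 hD3
  refine hne fun t ht => ?_
  have hVz : V t = 0 := funext fun x => by simpa using hz t ht x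
  exact (hVu t ht).symm.trans (Filter.EventuallyEq.of_eq hVz)

end Summit.NavierStokesRegularity.NavierStokesRegularity.Theorems.SimilarityEnstrophy
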